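import Mathlib
import Summits.Ventures.PercRepro2.HCov
import Summits.Ventures.PercRepro2.YBridge
import Summits.Ventures.PercRepro2.PocketConn
import Summits.Ventures.PercRepro2.PocketLaw
import Summits.Ventures.PercRepro2.PocketRowPD

/-!
# The masses of `HMFc` in a root-only pocket

The masses of `HMFc` other than `X̂` factor into a pocket factor and an outside mass by the pocket
law: `P(Q) = P(Q_P) · Z₁` (`prob_avoidAll_pocket`), `P(PD) = π₀ · Z₁`, `P(PD, a_x ↔ o) = π₀ · A_x¹`
(`prob_PDEvent_inter_conn`), `M₂ = π₀ · B_H¹` (`massM2_pocket`), `Δ_T = π₂ · (B_H¹ − B_L¹)`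
(`deltaT_pocket`), and the labelling gap `P(a₂ ↔ b) − P(a₁ ↔ b)`, whose parts off `Q` cancel, is
`P(Q_P) · (B_H¹ − B_L¹)` (`gap_pocket`).
-/

namespace Summit.Ventures.PercRepro2

namespace PocketConn

variable {V : Type*} {E : Type*} [Fintype V] [DecidableEq V]

variable {ends : E → Sym2 V} {P : Finset V} {a₁ a₂ a₃ : V}

/-- The PD event in a root-only pocket: `Q_P`, `a₃` reaches no root inside the pocket, and
`Q₁`. -/
lemma PDEvent_eq (hP : IsPocket ends (↑P : Set V) a₁ a₂) (h1 : a₁ ∉ P) (h2 : a₂ ∉ P)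
    (h3 : a₃ ∈ P) :
    PDEvent ends a₁ a₂ a₃ = PDPocket ends P a₁ a₂ a₃ ∩ QOutside ends (↑P : Set V) a₁ a₂ := by
  ext ω
  simp only [PDEvent, Dtilde, UnionCluster.inU, Set.mem_inter_iff, Set.mem_compl_iff,
    Set.mem_union, mem_connEvent, PDPocket, QOutside, Set.mem_setOf_eq, not_or]
  constructor
  · rintro ⟨hQ, h31, h32⟩
    have hsplit := not_or.1 ((conn_roots_iff (ω := ω) hP (by simpa using h1)
      (by simpa using h2)).not.1 hQ)
    exact ⟨⟨hsplit.1, fun h => h31 (conn_mono (restrict_le _ ω) h),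
      fun h => h32 (conn_mono (restrict_le _ ω) h)⟩, hsplit.2⟩
  · rintro ⟨⟨hQP, h31, h32⟩, hQ1⟩
    have hQ : ¬ Conn ends ω a₁ a₂ := by
      rw [conn_roots_iff hP (by simpa using h1) (by simpa using h2)]
      exact not_or.2 ⟨hQP, hQ1⟩
    refine ⟨hQ, fun h => h31 ?_, fun h => h32 ?_⟩
    · exact (conn_root_iff_conn_restrict hP hQ (Or.inl rfl) (by simpa using h3)).1 (conn_symm h)
    · exact (conn_root_iff_conn_restrict hP hQ (Or.inr rfl) (by simpa using h3)).1 (conn_symm h)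

/-- `PD ∩ {x ↔ v}` for `x, v` outside the pocket: the π₀ event times the outside event
`Q₁ ∩ {x ↔₁ v}`. -/
lemma PDEvent_inter_connEvent_eq (hP : IsPocket ends (↑P : Set V) a₁ a₂) (h1 : a₁ ∉ P)
    (h2 : a₂ ∉ P) (h3 : a₃ ∈ P) {x v : V} (hx : x ∉ P) (hv : v ∉ P) :
    PDEvent ends a₁ a₂ a₃ ∩ connEvent ends x v =
      PDPocket ends P a₁ a₂ a₃ ∩ (QOutside ends (↑P : Set V) a₁ a₂ ∩
        {ω | Conn ends (restrict (touches ends (↑P : Set V))ᶜ ω) x v}) := by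
  rw [PDEvent_eq hP h1 h2 h3]
  ext ω
  simp only [Set.mem_inter_iff, mem_connEvent, Set.mem_setOf_eq, and_assoc]
  constructor
  · rintro ⟨hπ, hQ1, hc⟩
    have hQ : ¬ Conn ends ω a₁ a₂ := by
      rw [conn_roots_iff hP (by simpa using h1) (by simpa using h2)]
      exact not_or.2 ⟨hπ.1, hQ1⟩
    exact ⟨hπ, hQ1, (conn_iff_conn_restrict hP hQ (by simpa using hx) (by simpa using hv)).1 hc⟩
  · rintro ⟨hπ, hQ1, hc⟩
    have hQ : ¬ Conn ends ω a₁ a₂ := by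
      rw [conn_roots_iff hP (by simpa using h1) (by simpa using h2)]
      exact not_or.2 ⟨hπ.1, hQ1⟩
    exact ⟨hπ, hQ1, (conn_iff_conn_restrict hP hQ (by simpa using hx) (by simpa using hv)).2 hc⟩

section Prob

variable [Fintype E] [DecidableEq E] {R : Type*} [CommRing R]

/-- `P(Q) = P(Q_P) · Z₁`. -/
theorem prob_avoidAll_pocket (p : E → R) (hP : IsPocket ends (↑P : Set V) a₁ a₂) (h1 : a₁ ∉ P)
    (h2 : a₂ ∉ P) :
    prob p (avoidAll ends a₂ {a₁}) =
      prob p (QPocket ends (↑P : Set V) a₁ a₂) * prob p (QOutside ends (↑P : Set V) a₁ a₂) := by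
  have e : avoidAll ends a₂ {a₁} = (connEvent ends a₁ a₂)ᶜ := by
    ext ω
    simp only [avoidAll, Set.mem_setOf_eq, Finset.mem_singleton, forall_eq, Set.mem_compl_iff,
      mem_connEvent]
    exact ⟨fun h h' => h (conn_symm h'), fun h h' => h (conn_symm h')⟩
  rw [e, compl_connEvent_eq_QPocket_inter_QOutside hP (by simpa using h1) (by simpa using h2)]
  exact prob_pocket_mul_outside p ends (↑P : Set V) (fun σ => ¬ Conn ends σ a₁ a₂)
    (fun σ => ¬ Conn ends σ a₁ a₂)

/-- `P(PD) = π₀ · Z₁`. -/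
theorem prob_PDEvent_pocket (p : E → R) (hP : IsPocket ends (↑P : Set V) a₁ a₂) (h1 : a₁ ∉ P)
    (h2 : a₂ ∉ P) (h3 : a₃ ∈ P) :
    prob p (PDEvent ends a₁ a₂ a₃) =
      prob p (PDPocket ends P a₁ a₂ a₃) * prob p (QOutside ends (↑P : Set V) a₁ a₂) := by
  rw [PDEvent_eq hP h1 h2 h3]
  exact prob_pocket_mul_outside p ends (↑P : Set V)
    (fun σ => ¬ Conn ends σ a₁ a₂ ∧ ¬ Conn ends σ a₃ a₁ ∧ ¬ Conn ends σ a₃ a₂)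
    (fun σ => ¬ Conn ends σ a₁ a₂)

/-- `P(PD, x ↔ v) = π₀ · P(Q₁, x ↔₁ v)` for `x, v` outside the pocket. -/
theorem prob_PDEvent_inter_conn (p : E → R) (hP : IsPocket ends (↑P : Set V) a₁ a₂)
    (h1 : a₁ ∉ P) (h2 : a₂ ∉ P) (h3 : a₃ ∈ P) {x v : V} (hx : x ∉ P) (hv : v ∉ P) :
    prob p (PDEvent ends a₁ a₂ a₃ ∩ connEvent ends x v) =
      prob p (PDPocket ends P a₁ a₂ a₃) * outMass p ends P a₁ a₂ x v := by
  rw [PDEvent_inter_connEvent_eq hP h1 h2 h3 hx hv, outMass]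
  have h := prob_pocket_mul_outside p ends (↑P : Set V)
    (fun σ => ¬ Conn ends σ a₁ a₂ ∧ ¬ Conn ends σ a₃ a₁ ∧ ¬ Conn ends σ a₃ a₂)
    (fun σ => ¬ Conn ends σ a₁ a₂ ∧ Conn ends σ x v)
  have e : QOutside ends (↑P : Set V) a₁ a₂ ∩
      {ω | Conn ends (restrict (touches ends (↑P : Set V))ᶜ ω) x v} =
      {ω | ¬ Conn ends (restrict (touches ends (↑P : Set V))ᶜ ω) a₁ a₂ ∧
        Conn ends (restrict (touches ends (↑P : Set V))ᶜ ω) x v} := by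
    ext ω
    simp only [QOutside, Set.mem_inter_iff, Set.mem_setOf_eq]
  rw [e]
  exact h

end Prob

section FieldMasses

variable [Fintype E] [DecidableEq E] {R : Type*} [Field R]

/-- `M₂ = π₀ · B_H¹`. -/
theorem massM2_pocket (p : E → R) (hP : IsPocket ends (↑P : Set V) a₁ a₂) (h1 : a₁ ∉ P)
    (h2 : a₂ ∉ P) (h3 : a₃ ∈ P) {b : V} (hb : b ∉ P) :
    massM2 p ends a₁ a₂ a₃ b = prob p (PDPocket ends P a₁ a₂ a₃) * outMass p ends P a₁ a₂ a₂ b :=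
  prob_PDEvent_inter_conn p hP h1 h2 h3 h2 hb

/-- `P(x ↔ v, T) = π₂ · P(Q₁, x ↔₁ v)` for `x, v` outside the pocket. -/
theorem prob_conn_inter_TEvent (p : E → R) (hP : IsPocket ends (↑P : Set V) a₁ a₂) (h1 : a₁ ∉ P)
    (h2 : a₂ ∉ P) (h3 : a₃ ∈ P) {x v : V} (hx : x ∉ P) (hv : v ∉ P) :
    prob p (connEvent ends x v ∩ TEvent ends a₁ a₂ a₃) =
      prob p {ω | ¬ Conn ends (restrict (touches ends (↑P : Set V)) ω) a₁ a₂ ∧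
          Conn ends (restrict (touches ends (↑P : Set V)) ω) a₃ a₂} *
        outMass p ends P a₁ a₂ x v := by
  have h := prob_Q_root_mul p hP (by simpa using h1) (by simpa using h2) (Or.inr rfl)
    (by simpa using h3) (fun σ => Conn ends σ x v)
  have e : (connEvent ends a₁ a₂)ᶜ ∩ connEvent ends a₂ a₃ ∩
      {ω | Conn ends (restrict (touches ends (↑P : Set V))ᶜ ω) x v} =
      connEvent ends x v ∩ TEvent ends a₁ a₂ a₃ := by
    ext ω
    simp only [Set.mem_inter_iff, Set.mem_compl_iff, mem_connEvent, Set.mem_setOf_eq, TEvent]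
    constructor
    · rintro ⟨⟨hQ, h23⟩, hc⟩
      exact ⟨(conn_iff_conn_restrict hP hQ (by simpa using hx) (by simpa using hv)).2 hc,
        fun h => hQ (conn_symm h), h23⟩
    · rintro ⟨hc, hQ', h23⟩
      have hQ : ¬ Conn ends ω a₁ a₂ := fun h => hQ' (conn_symm h)
      exact ⟨⟨hQ, h23⟩,
        (conn_iff_conn_restrict hP hQ (by simpa using hx) (by simpa using hv)).1 hc⟩
  rw [e] at h
  rw [h]
  rfl

/-- `Δ_T = π₂ · (B_H¹ − B_L¹)`. -/
theorem deltaT_pocket (p : E → R) (hP : IsPocket ends (↑P : Set V) a₁ a₂) (h1 : a₁ ∉ P)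
    (h2 : a₂ ∉ P) (h3 : a₃ ∈ P) {b : V} (hb : b ∉ P) :
    deltaT p ends a₁ a₂ a₃ b =
      prob p {ω | ¬ Conn ends (restrict (touches ends (↑P : Set V)) ω) a₁ a₂ ∧
          Conn ends (restrict (touches ends (↑P : Set V)) ω) a₃ a₂} *
        (outMass p ends P a₁ a₂ a₂ b - outMass p ends P a₁ a₂ a₁ b) := by
  rw [deltaT, prob_conn_inter_TEvent p hP h1 h2 h3 h2 hb, prob_conn_inter_TEvent p hP h1 h2 h3 h1 hb,
    mul_sub]

end FieldMasses

section Gap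

variable [Fintype E] [DecidableEq E] {R : Type*} [Field R]

omit [Fintype V] [DecidableEq V] in
/-- Off `Q` the two roots reach the same vertices: the labelling gap lives on `Q`. -/
lemma gap_eq_on_Q (p : E → R) (ends : E → Sym2 V) (a₁ a₂ b : V) :
    CovForm.gap p ends a₁ a₂ b =
      prob p ((connEvent ends a₁ a₂)ᶜ ∩ connEvent ends a₂ b) -
        prob p ((connEvent ends a₁ a₂)ᶜ ∩ connEvent ends a₁ b) := by
  have e2 := prob_inter_add_prob_inter_compl p (connEvent ends a₂ b) (connEvent ends a₁ a₂)
  have e1 := prob_inter_add_prob_inter_compl p (connEvent ends a₁ b) (connEvent ends a₁ a₂)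
  have hsame : connEvent ends a₂ b ∩ connEvent ends a₁ a₂ =
      connEvent ends a₁ b ∩ connEvent ends a₁ a₂ := by
    ext ω
    simp only [Set.mem_inter_iff, mem_connEvent]
    constructor
    · rintro ⟨h2b, h12⟩
      exact ⟨conn_trans h12 h2b, h12⟩
    · rintro ⟨h1b, h12⟩
      exact ⟨conn_trans (conn_symm h12) h1b, h12⟩
  rw [CovForm.gap, ← e2, ← e1, hsame,
    Set.inter_comm (connEvent ends a₂ b) (connEvent ends a₁ a₂)ᶜ,
    Set.inter_comm (connEvent ends a₁ b) (connEvent ends a₁ a₂)ᶜ]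
  ring

/-- `gap = P(Q_P) · (B_H¹ − B_L¹)`. -/
theorem gap_pocket (p : E → R) (hP : IsPocket ends (↑P : Set V) a₁ a₂) (h1 : a₁ ∉ P)
    (h2 : a₂ ∉ P) {b : V} (hb : b ∉ P) :
    CovForm.gap p ends a₁ a₂ b =
      prob p (QPocket ends (↑P : Set V) a₁ a₂) *
        (outMass p ends P a₁ a₂ a₂ b - outMass p ends P a₁ a₂ a₁ b) := by
  have key : ∀ x, x ∉ P → prob p ((connEvent ends a₁ a₂)ᶜ ∩ connEvent ends x b) =
      prob p (QPocket ends (↑P : Set V) a₁ a₂) * outMass p ends P a₁ a₂ x b := by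
    intro x hx
    have e : (connEvent ends a₁ a₂)ᶜ ∩ connEvent ends x b =
        QPocket ends (↑P : Set V) a₁ a₂ ∩ (QOutside ends (↑P : Set V) a₁ a₂ ∩
          {ω | Conn ends (restrict (touches ends (↑P : Set V))ᶜ ω) x b}) := by
      rw [compl_connEvent_eq_QPocket_inter_QOutside hP (by simpa using h1) (by simpa using h2)]
      ext ω
      simp only [Set.mem_inter_iff, mem_connEvent, QPocket, QOutside, Set.mem_setOf_eq, and_assoc]
      constructor
      · rintro ⟨hQP, hQ1, hc⟩
        have hQ : ¬ Conn ends ω a₁ a₂ := by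
          rw [conn_roots_iff hP (by simpa using h1) (by simpa using h2)]
          exact not_or.2 ⟨hQP, hQ1⟩
        exact ⟨hQP, hQ1,
          (conn_iff_conn_restrict hP hQ (by simpa using hx) (by simpa using hb)).1 hc⟩
      · rintro ⟨hQP, hQ1, hc⟩
        have hQ : ¬ Conn ends ω a₁ a₂ := by
          rw [conn_roots_iff hP (by simpa using h1) (by simpa using h2)]
          exact not_or.2 ⟨hQP, hQ1⟩
        exact ⟨hQP, hQ1,
          (conn_iff_conn_restrict hP hQ (by simpa using hx) (by simpa using hb)).2 hc⟩
    rw [e, outMass]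
    have h := prob_pocket_mul_outside p ends (↑P : Set V) (fun σ => ¬ Conn ends σ a₁ a₂)
      (fun σ => ¬ Conn ends σ a₁ a₂ ∧ Conn ends σ x b)
    have e' : QOutside ends (↑P : Set V) a₁ a₂ ∩
        {ω | Conn ends (restrict (touches ends (↑P : Set V))ᶜ ω) x b} =
        {ω | ¬ Conn ends (restrict (touches ends (↑P : Set V))ᶜ ω) a₁ a₂ ∧
          Conn ends (restrict (touches ends (↑P : Set V))ᶜ ω) x b} := by
      ext ω
      simp only [QOutside, Set.mem_inter_iff, Set.mem_setOf_eq]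
    rw [e']
    exact h
  rw [gap_eq_on_Q, key a₂ h2, key a₁ h1, mul_sub]

end Gap

end PocketConn

end Summit.Ventures.PercRepro2
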